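import Summits.RiemannHypothesis.RiemannHypothesis.Theorems.JensenPolynomialsEffectiveKimLeeRadius
import Summits.RiemannHypothesis.RiemannHypothesis.Theorems.JensenPolynomialsChainDefs
import Literature.Barriers.RiemannHypothesis.JensenPolynomialsKimCorollary
import Literature.NumberTheory.LFunctions.JensenHyperbolicityRangesRS
import Literature.NumberTheory.LFunctions.EquivalentsJensenProofs

/-!
# Rung J-P(P1″) «√d·log d range» — the LEAF `JensenSqrtLogRangeTwenty` PROVED: `J^{d,n}_γ` is
# hyperbolic whenever `n ≥ 20 000` and `20·√d·log n ≤ n` (RH-FREE proof-of-data; cell rh-jensen,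
# HUMAN RULING D-0040, ladder RH column JENSEN)

RH-FREE. The second rung of the Jensen column, on the ZERO side (effective Kim–Lee): for the Taylor
data `γ = xiTaylorCoeff` of `ξ`,

* `jensenSqrtLogRangeTwenty_holds : JensenSqrtLogRangeTwenty`
  (`∀ d n, 20000 ≤ n → 20·√d·log n ≤ n → (jensenPoly xiTaylorCoeff d n).Splits`, the registered leaf
  of `JensenPolynomialsChainDefs.lean`), i.e. `N(d) ≲ C·√d·log d` — Kim–Lee 2021 Thm. 1
  (`N(Ξ₀; d) = O(d^{1/2+ε})`, INEFFECTIVE, tree named fact `kimLee_thm1`) made EFFECTIVE and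
  log-sharp; against the first rung's cubic leaf `JensenCubicRangeTwo` (`n ≥ 2d³`).

Assembly (this file) = idea-2 g0's KERNEL-CHECKED REDUCTION (HOME `rh-jensen-idea-2/NegationLensSketch.lean`,
planner-rh-jensen-idea-2-g0-0, re-verified on the farm 2026-08-26) ported to the tree's vocabulary
(`XiDerivNonrealZeroBeyond`, `JensenWideBandBelow`, `chainRadius` of `JensenPolynomialsChainDefs.lean`):

1. `splits_jensenPoly_of_derivZeros_mem_sector` — the SHIFTED sector theorem: if all zeros of `G⁽ⁿ⁾`
   (`G = xiSq`) lie in the double sector `S(δ)` and `d δ² ≤ 1` then `J^{d,n}_γ` is hyperbolic (the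
   tree's Kim–Lee genus-one sector theorem `KimLee.splits_jensenPoly_taylor_of_zeros_mem_sector_two`
   applied to `F = G⁽ⁿ⁾`, reindexed by `iteratedDeriv_add_eq`, `re_iteratedDeriv_xiSq`, `jensenPoly_shift`);
2. `abs_im_le_of_iteratedDeriv_xiSq_eq_zero` — every zero `z` of `G⁽ⁿ⁾` has
   `|Im z| ≤ (1 + √n) + √‖z‖` (backward Jensen chain `exists_jensen_chain`, `chain_variation_le`, root
   zero in the parabola `EffectiveKimLee.abs_im_le_sqrt_norm_of_xiSq_eq_zero`);
3. `wideBand_of_beyond : XiDerivNonrealZeroBeyond R → JensenWideBandBelow R` — a radius free of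
   non-real zeros of `G⁽ⁿ⁾` ALONE gives the band `2d + (1+√n)√(2d) ≤ R n ⇒ J^{d,n}_γ hyperbolic`;
4. the crux instance `xiDerivNonrealZeroBeyond_chainRadius` (radius `chainRadius n = (n/log n)²/64`
   for `n ≥ 65536`, `0` below) = prover-rh-jensen-eng-2-g4-0's
   `EffectiveKimLee.xiSq_derivZeros_nonreal_far` (Ki–Kim chain + Gontcharoff at the anchor
   `ξ₁(¼) = ξ(1) = ½` + explicit Titchmarsh growth, `JensenPolynomialsEffectiveKimLee{,Radius}.lean`);
5. the arithmetic `band_arith` : `65536 ≤ n`, `20√d·log n ≤ n ⇒ 2d + (1+√n)√(2d) ≤ chainRadius n`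
   (i.e. `6.66(1+√n) ≤ n/log n`, from `log n/√n ≤ log 2/16`);
6. the SMALL SHIFTS `20000 ≤ n < 65536`: there `20√d·log n ≤ n` forces `√d ≤ 65536/(20·9) < 1000`,
   i.e. `d < 10⁶`, and every such cell is the tree's kernel theorem
   `jensenPoly_xiTaylorCoeff_splits_allShifts_of_le_1e6'` (`d ≤ 10⁶`, all shifts; Kim–Lee Thm. 4 with
   RH verified to height `1000`, standard axioms) — so NO chain budget below `2¹⁶` is needed.

WHAT THIS IS NOT: a hyperbolicity RANGE `n ≥ N(d)` with `N(d) → ∞`; by the tree's barrier entries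
`Literature.Barriers.RiemannHypothesis.JensenPolynomials{,ShiftUniform,Sqrt,Cone}` (Farmer 2022) such
a range carries no information about RH; nothing here bears on zeros of `ζ` off the critical line or on
the truth of RH. Line: idea-2 g0 card `idea-effective-kim-lee.md` (evidence on
`stmt-RiemannHypothesis-19715`); rung J-P(P1″) chosen by planner-rh-jensen-theory-g9-0 (2026-08-26
19:47Z). Landed `--supports stmt-RiemannHypothesis-19715` by prover-rh-jensen-prover-g6-0.

## References
* [KimLee2021] Y.-O. Kim, J. Lee, *A note on the zeros of Jensen polynomials*, J. Korean Math. Soc.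
  59 (2022) 775–787 = arXiv:2105.05386, Thms. 1, 2, 3, 4.
* [KiKim2000] H. Ki, Y.-O. Kim, Duke Math. J. 104 (2000) 45–73, §2.
* [GORZPNAS2019] Griffin–Ono–Rolen–Zagier, PNAS 116 (2019) 11103–11110.
-/

noncomputable section
-- D-0017: `Summit.RiemannHypothesis.RiemannHypothesis.…` duplicates the namespace BY DESIGN (single-problem summit).
set_option linter.dupNamespace false

open Complex Polynomial
open scoped ComplexConjugate

namespace Summit.RiemannHypothesis.RiemannHypothesis.Theorems.JensenPolynomials.KimLee

open Literature.NumberTheory.LFunctions Literature.Analysis.Complex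
  Literature.Analysis.Complex.Obreschkoff Literature.Barriers.RiemannHypothesis
open Summit.RiemannHypothesis.RiemannHypothesis.Theorems.JensenPolynomials.EffectiveKimLee

/-! ## 1. The shifted sector theorem for `G⁽ⁿ⁾` -/

/-- Real numbers are in every sector of non-negative opening. [folklore] -/
theorem mem_sector_of_im_eq_zero {δ : ℝ} (hδ : 0 ≤ δ) {z : ℂ} (hz : z.im = 0) : z ∈ sector δ := by
  rw [mem_sector, hz, abs_zero]; exact mul_nonneg hδ (norm_nonneg z)

/-- No derivative of `G` vanishes at `0`: `Re G⁽ⁿ⁾(0) = γ(n)/8 > 0`. [cite: GORZPNAS2019, §1] -/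
theorem iteratedDeriv_xiSq_zero_ne (n : ℕ) : iteratedDeriv n xiSq 0 ≠ 0 := by
  intro h
  have h1 := re_iteratedDeriv_xiSq n
  rw [h, Complex.zero_re] at h1
  have h2 := xiTaylorCoeff_pos_holds n
  have h3 : xiTaylorCoeff n = 0 := by
    rcases mul_eq_zero.1 h1.symm with h8 | h8
    · norm_num at h8
    · exact h8
  exact h2.ne' h3

/-- **Shifted sector theorem (RH-FREE).** If all zeros of `G⁽ⁿ⁾` lie in the double sector `S(δ)` and
`d δ² ≤ 1`, then `J^{d,n}_γ` is hyperbolic: the tree's Kim–Lee genus-one sector theorem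
`KimLee.splits_jensenPoly_taylor_of_zeros_mem_sector_two` for `F = G⁽ⁿ⁾` (entire of order `< 2` by
`exists_growth_iteratedDeriv`, real by `im_iteratedDeriv_ofReal`, `F 0 ≠ 0`), reindexed:
`J(F; d) = 8⁻¹ · J^{d,n}_γ`. (Port of idea-2 g0's `jensenShiftSector_holds`.) [cite: KimLee2021, Theorem 3] -/
theorem splits_jensenPoly_of_derivZeros_mem_sector (n : ℕ) (δ : ℝ)
    (hzero : ∀ z : ℂ, iteratedDeriv n xiSq z = 0 → z ∈ sector δ) (d : ℕ) (hd : (d : ℝ) * δ ^ 2 ≤ 1) :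
    (jensenPoly xiTaylorCoeff d n).Splits := by
  obtain ⟨C, hC⟩ := norm_xiSq_le
  obtain ⟨ρ', C', hρ'0, hρ', hgr'⟩ :=
    exists_growth_iteratedDeriv differentiable_xiSq (by norm_num : (0 : ℝ) ≤ 7 / 8)
      (by norm_num : (7 / 8 : ℝ) < 2) hC n
  have hF : Differentiable ℂ (iteratedDeriv n xiSq) :=
    differentiable_iteratedDeriv_of_entire differentiable_xiSq n
  have hFreal : ∀ x : ℝ, (iteratedDeriv n xiSq x).im = 0 :=
    im_iteratedDeriv_ofReal differentiable_xiSq im_xiSq_ofReal n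
  have h := KimLee.splits_jensenPoly_taylor_of_zeros_mem_sector_two hF hρ'0 hρ' hgr'
    (apply_conj_eq_conj hF hFreal) (iteratedDeriv_xiSq_zero_ne n) hzero hd
  have hcoef : (fun k => (iteratedDeriv k (iteratedDeriv n xiSq) 0).re) =
      fun k => 8⁻¹ * xiTaylorCoeff (n + k) := by
    funext k
    rw [← iteratedDeriv_add_eq, re_iteratedDeriv_xiSq]
  rw [hcoef, PolyaSchur.jensenPoly_const_mul, ← jensenPoly_shift] at h
  have h8 : jensenPoly xiTaylorCoeff d n =
      Polynomial.C (8 : ℝ) * (Polynomial.C (8⁻¹ : ℝ) * jensenPoly xiTaylorCoeff d n) := by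
    rw [← mul_assoc, ← C_mul, mul_inv_cancel₀ (by norm_num : (8 : ℝ) ≠ 0), C_1, one_mul]
  rw [h8]
  exact h.C_mul 8

/-! ## 2. Every zero of `G⁽ⁿ⁾` is near the real axis: `|Im z| ≤ (1 + √n) + √‖z‖` -/

/-- **RH-FREE:** every zero `z` of `G⁽ⁿ⁾` satisfies `|Im z| ≤ (1 + √n) + √‖z‖` (backward Jensen chain
to a zero `z₀ = (ρ−½)²` of `G`; `Im` decreases along the chain; `Im z₀ ≤ √‖z₀‖`; variation
`≤ Im z₀ (1 + √n)`). (Port of idea-2 g0's `xiDerivZerosNearReal_holds`.) [cite: KiKim2000, §2 eq. (2.5)] -/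
theorem abs_im_le_of_iteratedDeriv_xiSq_eq_zero (n : ℕ) (w : ℂ) (hw : iteratedDeriv n xiSq w = 0) :
    |w.im| ≤ (1 + Real.sqrt n) + Real.sqrt ‖w‖ := by
  obtain ⟨C, hC⟩ := norm_xiSq_le
  have h78 : (0 : ℝ) ≤ 7 / 8 := by norm_num
  have h78' : (7 / 8 : ℝ) < 2 := by norm_num
  have key : ∀ u : ℂ, 0 < u.im → iteratedDeriv n xiSq u = 0 →
      u.im ≤ (1 + Real.sqrt n) + Real.sqrt ‖u‖ := by
    intro u hu hfu
    obtain ⟨z, hzn, hzero, hpos, hrel⟩ := exists_jensen_chain differentiable_xiSq h78 h78' hC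
      im_xiSq_ofReal iteratedDeriv_xiSq_ne_zero n hu hfu
    have hV := chain_variation_le hpos hrel
    -- imaginary parts decrease along the chain
    have hmono : ∀ k, k ≤ n → (z k).im ≤ (z 0).im := by
      intro k
      induction k with
      | zero => intro _; exact le_rfl
      | succ k ih =>
        intro hk
        have h1 := hrel k (Nat.lt_of_succ_le hk)
        have h2 := hpos (k + 1) hk
        have h3 := hpos k (Nat.le_of_succ_le hk)
        have h4 : (z (k + 1)).im ≤ (z k).im := by
          nlinarith [sq_nonneg ((z (k + 1)).re - (z k).re)]
        exact h4.trans (ih (Nat.le_of_succ_le hk))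
    have himw : u.im ≤ (z 0).im := by rw [← hzn]; exact hmono n le_rfl
    -- the root zero lies in the parabola: `Im z₀ ≤ √‖z₀‖`
    have hz0 : xiSq (z 0) = 0 := by simpa using hzero 0 (Nat.zero_le _)
    have hroot : (z 0).im ≤ Real.sqrt ‖z 0‖ :=
      (le_abs_self _).trans (abs_im_le_sqrt_norm_of_xiSq_eq_zero hz0)
    -- telescoping: `‖z₀‖ ≤ ‖u‖ + V`
    have htel : ‖z 0‖ ≤ ‖u‖ + ∑ k ∈ Finset.range n, ‖z k - z (k + 1)‖ := by
      have hsum : z 0 - z n = ∑ k ∈ Finset.range n, (z k - z (k + 1)) :=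
        (Finset.sum_range_sub' z n).symm
      have heq : z 0 = z n + (z 0 - z n) := by abel
      calc ‖z 0‖ = ‖z n + (z 0 - z n)‖ := by rw [← heq]
        _ ≤ ‖z n‖ + ‖z 0 - z n‖ := norm_add_le _ _
        _ ≤ ‖u‖ + ∑ k ∈ Finset.range n, ‖z k - z (k + 1)‖ := by
            rw [hsum, hzn]
            linarith [norm_sum_le (Finset.range n) fun k => z k - z (k + 1)]
    -- `t := √‖z₀‖` satisfies `t² ≤ ‖u‖ + t (1 + √n)`, hence `t ≤ (1 + √n) + √‖u‖`
    set t : ℝ := Real.sqrt ‖z 0‖ with ht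
    have ht0 : 0 ≤ t := Real.sqrt_nonneg _
    have ht2 : t ^ 2 = ‖z 0‖ := Real.sq_sqrt (norm_nonneg _)
    have hs1 : (1 : ℝ) ≤ 1 + Real.sqrt n := le_add_of_nonneg_right (Real.sqrt_nonneg _)
    have hs0 : (0 : ℝ) ≤ 1 + Real.sqrt n := zero_le_one.trans hs1
    have hineq : t ^ 2 ≤ ‖u‖ + t * (1 + Real.sqrt n) := by
      rw [ht2]
      calc ‖z 0‖ ≤ ‖u‖ + ∑ k ∈ Finset.range n, ‖z k - z (k + 1)‖ := htel
        _ ≤ ‖u‖ + (z 0).im * (1 + Real.sqrt n) := by linarith [hV]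
        _ ≤ ‖u‖ + t * (1 + Real.sqrt n) := by
            have := mul_le_mul_of_nonneg_right hroot hs0
            linarith
    have hsu : 0 ≤ Real.sqrt ‖u‖ := Real.sqrt_nonneg _
    have hsu2 : Real.sqrt ‖u‖ * Real.sqrt ‖u‖ = ‖u‖ := Real.mul_self_sqrt (norm_nonneg _)
    have htle : t ≤ (1 + Real.sqrt n) + Real.sqrt ‖u‖ := by
      by_contra hlt
      push Not at hlt
      have htpos : 0 < t := by linarith
      have hq : Real.sqrt ‖u‖ ≤ t := by linarith
      have h1 : t * Real.sqrt ‖u‖ < t * (t - (1 + Real.sqrt n)) :=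
        mul_lt_mul_of_pos_left (by linarith) htpos
      have h2 : Real.sqrt ‖u‖ * Real.sqrt ‖u‖ ≤ t * Real.sqrt ‖u‖ :=
        mul_le_mul_of_nonneg_right hq hsu
      nlinarith [h1, h2, hineq, hsu2]
    exact himw.trans (hroot.trans htle)
  rcases lt_trichotomy w.im 0 with hneg | h0 | hpos
  · have hrefl : iteratedDeriv n xiSq (conj w) = conj (iteratedDeriv n xiSq w) :=
      apply_conj_eq_conj (differentiable_iteratedDeriv_of_entire differentiable_xiSq n)
        (im_iteratedDeriv_ofReal differentiable_xiSq im_xiSq_ofReal n) w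
    have h := key (conj w) (by simpa using hneg) (by rw [hrefl, hw, map_zero])
    rw [Complex.conj_im, Complex.norm_conj] at h
    rw [abs_of_neg hneg]; exact h
  · rw [h0, abs_zero]; positivity
  · rw [abs_of_pos hpos]; exact key w hpos hw

/-! ## 3. The wide band from a radius free of non-real zeros -/

/-- **GENERIC GLUE (RH-FREE):** a radius function `R` below which no `G⁽ⁿ⁾` has a NON-REAL zero
ALONE gives the wide band `2d + (1+√n)√(2d) ≤ R n ⇒ J^{d,n}_γ hyperbolic`. For a non-real zero `z`,
`r = ‖z‖ ≥ R n`: `Im² ≤ ((1+√n) + √r)² ≤ 2(1+√n)² + 2r ≤ r²/d` because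
`(r − d)² ≥ (d + (1+√n)√(2d))² ≥ d² + 2d(1+√n)²`, so `z ∈ S(1/√d)`; real zeros are in every sector.
(Port of idea-2 g0's `wideBand_of_beyond`.) [cite: KimLee2021, Theorem 1 (proof)] -/
theorem wideBand_of_beyond {R : ℕ → ℝ} (hR : XiDerivNonrealZeroBeyond R) : JensenWideBandBelow R := by
  intro d n hd
  rcases Nat.eq_zero_or_pos d with rfl | hdpos
  · exact Splits.of_natDegree_eq_zero
      (Nat.le_zero.1 (PolyaSchur.natDegree_jensenPoly_le xiTaylorCoeff 0 n))
  have hd1 : (1 : ℝ) ≤ d := by exact_mod_cast hdpos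
  have hdR : (0 : ℝ) < (d : ℝ) := by linarith
  set δ : ℝ := (Real.sqrt d)⁻¹ with hδdef
  have hsq : 0 < Real.sqrt d := Real.sqrt_pos.2 hdR
  have hδ0 : 0 ≤ δ := by positivity
  set s : ℝ := 1 + Real.sqrt n with hsdef
  have hs0 : 0 ≤ s := by positivity
  have h2d : Real.sqrt (2 * d) ^ 2 = 2 * d := Real.sq_sqrt (by positivity)
  have h2d0 : 0 ≤ Real.sqrt (2 * d) := Real.sqrt_nonneg _
  refine splits_jensenPoly_of_derivZeros_mem_sector n δ ?_ d ?_
  · intro z hz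
    by_cases him : z.im = 0
    · exact mem_sector_of_im_eq_zero hδ0 him
    have hfar : 2 * (d : ℝ) + s * Real.sqrt (2 * d) ≤ ‖z‖ := le_trans hd (hR n z hz him)
    have hnear : |z.im| ≤ s + Real.sqrt ‖z‖ := abs_im_le_of_iteratedDeriv_xiSq_eq_zero n z hz
    have hr0 : 0 ≤ ‖z‖ := norm_nonneg z
    have hsr : Real.sqrt ‖z‖ ^ 2 = ‖z‖ := Real.sq_sqrt hr0
    have hsr0 : 0 ≤ Real.sqrt ‖z‖ := Real.sqrt_nonneg _
    -- Im² ≤ 2 s² + 2 r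
    have hIm2 : z.im ^ 2 ≤ 2 * s ^ 2 + 2 * ‖z‖ := by
      have h1 : z.im ^ 2 = |z.im| ^ 2 := (sq_abs _).symm
      have h2 : |z.im| ^ 2 ≤ (s + Real.sqrt ‖z‖) ^ 2 :=
        pow_le_pow_left₀ (abs_nonneg _) hnear 2
      nlinarith [h1, h2, hsr, sq_nonneg (s - Real.sqrt ‖z‖)]
    -- r² ≥ 2 d r + 2 d s²
    have hkey : z.im ^ 2 * d ≤ ‖z‖ ^ 2 := by
      have h3 : (d : ℝ) + s * Real.sqrt (2 * d) ≤ ‖z‖ - d := by linarith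
      have h4 : ((d : ℝ) + s * Real.sqrt (2 * d)) ^ 2 ≤ (‖z‖ - d) ^ 2 :=
        pow_le_pow_left₀ (by positivity) h3 2
      have h5 : (d : ℝ) ^ 2 + 2 * d * s ^ 2 ≤ ((d : ℝ) + s * Real.sqrt (2 * d)) ^ 2 := by
        nlinarith [h2d, mul_nonneg (mul_nonneg hdR.le hs0) h2d0]
      nlinarith [hIm2, h4, h5, hdR.le]
    rw [mem_sector]
    have hsqd : Real.sqrt d ^ 2 = d := Real.sq_sqrt hdR.le
    have h3 : (|z.im| * Real.sqrt d) ^ 2 ≤ ‖z‖ ^ 2 := by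
      rw [mul_pow, sq_abs, hsqd]; exact hkey
    have h4 : |z.im| * Real.sqrt d ≤ ‖z‖ := by
      have := Real.sqrt_le_sqrt h3
      rwa [Real.sqrt_sq (by positivity), Real.sqrt_sq (norm_nonneg z)] at this
    rw [hδdef]
    rw [← le_div_iff₀ hsq] at h4
    simpa [div_eq_mul_inv, mul_comm] using h4
  · have h1 : (d : ℝ) * δ ^ 2 = 1 := by
      rw [hδdef, inv_pow, Real.sq_sqrt hdR.le, mul_inv_cancel₀ hdR.ne']
    exact h1.le

/-! ## 4. The crux instance and the band arithmetic -/

/-- **The crux in the typed shape (RH-FREE):** no NON-REAL zero of `G⁽ⁿ⁾` below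
`chainRadius n = (n/log n)²/64` for `n ≥ 65536` (no claim below) — prover-rh-jensen-eng-2-g4-0's
`EffectiveKimLee.xiSq_derivZeros_nonreal_far`. [cite: KimLee2021, Theorem 2] -/
theorem xiDerivNonrealZeroBeyond_chainRadius :
    XiDerivNonrealZeroBeyond (fun n ↦ if 65536 ≤ n then chainRadius n else 0) := by
  intro n z hz him
  dsimp only
  split_ifs with h
  · have h1 := xiSq_derivZeros_nonreal_far n h z hz him
    unfold chainRadius
    linarith
  · exact norm_nonneg z

/-- **Band arithmetic (RH-FREE, elementary):** for `n ≥ 65536` and `20√d·log n ≤ n`,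
`2d + (1+√n)√(2d) ≤ (n/log n)²/64`. (With `q = n/log n`: `√d ≤ q/20`, so the left side is
`≤ q²/200 + 0.0708(1+√n)q`, and `1 + √n ≤ 1.004·0.0434·q` because `log n/√n ≤ log 2/16`.)
[folklore] -/
theorem band_arith {d n : ℕ} (hn : 65536 ≤ n) (hdn : 20 * Real.sqrt d * Real.log n ≤ n) :
    2 * (d : ℝ) + (1 + Real.sqrt n) * Real.sqrt (2 * d) ≤ chainRadius n := by
  unfold chainRadius
  have hx : (65536 : ℝ) ≤ n := by exact_mod_cast hn
  have hn0 : (0 : ℝ) < n := by linarith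
  have hL : 11.09 ≤ Real.log (n : ℝ) := log_ge hx
  have hLpos : 0 < Real.log (n : ℝ) := by linarith
  set L : ℝ := Real.log (n : ℝ) with hLdef
  set s : ℝ := Real.sqrt (n : ℝ) with hsdef
  have hs256 : (256 : ℝ) ≤ s := by
    rw [hsdef, ← sqrt_65536]; exact Real.sqrt_le_sqrt hx
  have hs2 : s ^ 2 = n := Real.sq_sqrt hn0.le
  -- `L ≤ 0.0434 s`
  have hLs : L ≤ 0.0434 * s := by
    have h1 := log_div_sqrt_le hx
    have h2 := Real.log_two_lt_d9
    rw [div_le_iff₀ (by linarith)] at h1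
    nlinarith [h1, h2]
  set q : ℝ := (n : ℝ) / L with hqdef
  have hqpos : 0 < q := div_pos hn0 hLpos
  have hqL : q * L = n := by rw [hqdef]; field_simp
  -- `√d ≤ q/20`
  set t : ℝ := Real.sqrt d with htdef
  have ht0 : 0 ≤ t := Real.sqrt_nonneg _
  have ht2 : t ^ 2 = d := Real.sq_sqrt (Nat.cast_nonneg d)
  have htq : t ≤ q / 20 := by
    rw [le_div_iff₀ (by norm_num : (0 : ℝ) < 20), hqdef, le_div_iff₀ hLpos]
    linarith
  -- `s ≤ 0.0434 q` (from `s² = n = q L ≤ q · 0.0434 s`)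
  have hsq : s ≤ 0.0434 * q := by
    have h1 : s * s ≤ (0.0434 * q) * s := by
      calc s * s = q * L := by rw [← sq, hs2, hqL]
        _ ≤ q * (0.0434 * s) := mul_le_mul_of_nonneg_left hLs hqpos.le
        _ = (0.0434 * q) * s := by ring
    exact le_of_mul_le_mul_right h1 (by linarith)
  -- `√(2d) = √2 t ≤ 1.4143 t`
  have h2d : Real.sqrt (2 * (d : ℝ)) ≤ 1.4143 * t := by
    rw [htdef, Real.sqrt_le_iff]
    refine ⟨by positivity, ?_⟩
    rw [mul_pow, Real.sq_sqrt (Nat.cast_nonneg d)]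
    nlinarith
  have h1s : 1 + s ≤ 1.004 * s := by linarith
  -- assemble
  have hA : 2 * (d : ℝ) ≤ q ^ 2 / 200 := by rw [← ht2]; nlinarith [htq, ht0]
  have hB : (1 + s) * Real.sqrt (2 * d) ≤ (1.004 * s) * (1.4143 * (q / 20)) := by
    refine mul_le_mul h1s (h2d.trans ?_) (Real.sqrt_nonneg _) (by positivity)
    nlinarith [htq]
  have hC : (1.004 * s) * (1.4143 * (q / 20)) ≤ 0.0031 * q ^ 2 := by nlinarith [hsq, hqpos]
  have hgoal : 2 * (d : ℝ) + (1 + s) * Real.sqrt (2 * d) ≤ q ^ 2 / 64 := by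
    nlinarith [hA, hB, hC, sq_nonneg q]
  simpa [hqdef] using hgoal

/-! ## 5. The small shifts `n < 65536`: `d < 10⁶`, a tree theorem -/

/-- `9 ≤ log 20000` (`e⁹ < 8104 < 20000`). [folklore] -/
theorem nine_le_log_20000 : (9 : ℝ) ≤ Real.log 20000 := by
  rw [Real.le_log_iff_exp_le (by norm_num)]
  have h1 : Real.exp 1 < 2.7182818286 := Real.exp_one_lt_d9
  have h9 : Real.exp 9 = Real.exp 1 ^ 9 := by rw [← Real.exp_nat_mul]; norm_num
  rw [h9]
  have h2 : Real.exp 1 ^ 9 ≤ (2.7182818286 : ℝ) ^ 9 :=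
    pow_le_pow_left₀ (Real.exp_pos 1).le h1.le 9
  have h3 : (2.7182818286 : ℝ) ^ 9 ≤ 20000 := by norm_num
  linarith

/-- **Small shifts (RH-FREE, a tree certificate):** for `20000 ≤ n < 65536` the hypothesis
`20√d·log n ≤ n` forces `√d ≤ 65536/180 < 1000`, hence `d ≤ 10⁶`, and `J^{d,n}_γ` is hyperbolic by
the tree's `jensenPoly_xiTaylorCoeff_splits_allShifts_of_le_1e6'`. [cite: KimLee2021, Theorem 4] -/
theorem splits_of_small_shift {d n : ℕ} (hn : 20000 ≤ n) (hn' : n < 65536)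
    (hdn : 20 * Real.sqrt d * Real.log n ≤ n) : (jensenPoly xiTaylorCoeff d n).Splits := by
  refine jensenPoly_xiTaylorCoeff_splits_allShifts_of_le_1e6' ?_ n
  have hx : (20000 : ℝ) ≤ n := by exact_mod_cast hn
  have hx' : (n : ℝ) < 65536 := by exact_mod_cast hn'
  have hL : 9 ≤ Real.log (n : ℝ) := nine_le_log_20000.trans (Real.log_le_log (by norm_num) hx)
  have ht0 : 0 ≤ Real.sqrt (d : ℝ) := Real.sqrt_nonneg _
  have ht : Real.sqrt (d : ℝ) ≤ 1000 := by
    by_contra h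
    push Not at h
    have : (20 * 1000 * 9 : ℝ) < 20 * Real.sqrt d * Real.log n := by
      have h1 : (20 * 1000 : ℝ) * 9 ≤ 20 * 1000 * Real.log n := by nlinarith
      have h2 : 20 * 1000 * Real.log (n : ℝ) < 20 * Real.sqrt d * Real.log n := by
        have hL0 : 0 < Real.log (n : ℝ) := by linarith
        nlinarith
      linarith
    linarith
  have hd : (d : ℝ) ≤ 1000000 := by
    have h2 : Real.sqrt (d : ℝ) ^ 2 ≤ 1000 ^ 2 := pow_le_pow_left₀ ht0 ht 2
    rw [Real.sq_sqrt (Nat.cast_nonneg d)] at h2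
    linarith
  exact_mod_cast hd

/-! ## 6. The leaf -/

/-- **RUNG J-P(P1″) LEAF, PROVED (RH-FREE): `JensenSqrtLogRangeTwenty`** — for all `d` and all
`n ≥ 20 000` with `20·√d·log n ≤ n`, the Jensen polynomial `J^{d,n}_γ` of `ξ`'s Taylor data is
hyperbolic (`N(d) ≲ C√d·log d`: Kim–Lee 2021 Thm. 1 made effective). Small shifts by the `d ≤ 10⁶`
certificate, large shifts by the effective Kim–Lee radius and the wide band.
[cite: KimLee2021, Theorems 1, 2] [cite: KiKim2000, §2] -/
theorem jensenSqrtLogRangeTwenty_holds : JensenSqrtLogRangeTwenty := by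
  intro d n hn hdn
  by_cases hsmall : n < 65536
  · exact splits_of_small_shift hn hsmall hdn
  · push Not at hsmall
    have hband := wideBand_of_beyond xiDerivNonrealZeroBeyond_chainRadius d n
    simp only [if_pos hsmall] at hband
    exact hband (band_arith hsmall hdn)

/-- The leaf unfolded (for consumers that do not open the `ChainDefs` vocabulary): `J^{d,n}_γ` splits
whenever `n ≥ 20000` and `20·√d·log n ≤ n`. RH-FREE. [cite: KimLee2021, Theorem 1] -/
theorem jensenPoly_xiTaylorCoeff_splits_of_sqrt_mul_log_le {d n : ℕ} (hn : 20000 ≤ n)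
    (hdn : 20 * Real.sqrt d * Real.log n ≤ n) : (jensenPoly xiTaylorCoeff d n).Splits :=
  jensenSqrtLogRangeTwenty_holds d n hn hdn

end Summit.RiemannHypothesis.RiemannHypothesis.Theorems.JensenPolynomials.KimLee

end
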